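import Summits.ResolutionOfSingularities.ResolutionOfSingularities.Theorems.FrobeniusLadderFRationalResolutionGaloisOrbitAssembly
import Literature.AlgebraicGeometry.Resolution.AlterationsLemma32
import Mathlib.AlgebraicGeometry.Morphisms.Smooth
import Mathlib.RingTheory.Etale.Field
import Mathlib.RingTheory.Smooth.Basic
import Mathlib.RingTheory.RingHom.Smooth
import Mathlib.RingTheory.FiniteStability
import HarnessLib

/-!
# Crux `FrobeniusLadder.FRationalResolution` (stmt-ResolutionOfSingularities-15317), line `redirect`,
# stub `stub_diagonalizableQuotientResolution` — regularity ASCENDS along the separable base change `Spec(B ⊗_K K') → Spec B`;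
# the Galois-route assembly with this hypothesis discharged

`…GaloisOrbitAssembly.hloc_of_decomposition_stable_piece` (✓) carried the hypothesis «`Spec(B ⊗_K K')` is regular at the primes not
over `𝔭`». For `K'/K` finite separable the base change is SMOOTH (Mathlib: separable ⇒ formally étale ⇒ smooth; smooth is
stable under base change), and regularity ascends along smooth morphisms (EGA IV 17.5.8 (iii), tree
`Literature.….isRegularLocalRing_stalk_of_smooth`), so that hypothesis follows from «`Spec B` is regular off `𝔭`».

* `smooth_specMap_baseChange` — `Spec(B ⊗_K K') → Spec B` is smooth for `K'/K` finite separable;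
* `mem_regularLocus_baseChange` — a point of `Spec(B ⊗_K K')` over a regular point of `Spec B` is regular (`B` Noetherian);
* **`hloc_of_decomposition_stable_piece'`**, **`hasResolution_of_decomposition_stable_pieces'`** — the Galois-route assembly with
  the off-`𝔭` regularity hypothesis removed.

Honest label: plumbing (no stub closed by name); the remaining hypotheses are the one-point data (`K'`, `𝔔'`, a decomposition-stable
primary piece with locally regular blow-up). No definitions, no named facts, no sorry.
[cite: Grothendieck1967, Prop. 17.5.8 (iii)] [cite: StacksProject, Tag 0CDQ; Tag 09EB] [cite: Kollar2007, §2.2]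
-/

noncomputable section

-- single-problem summit: the doubled namespace component is forced
set_option linter.dupNamespace false

open CategoryTheory AlgebraicGeometry TopologicalSpace TensorProduct
open Literature.AlgebraicGeometry.Resolution
open Summit.ResolutionOfSingularities.ResolutionOfSingularities.Theorems.FRationalResolution

namespace Summit.ResolutionOfSingularities.ResolutionOfSingularities.Theorems.FRationalResolution.GaloisBaseChangeRegular

/-- **The separable base change `Spec(B ⊗_K K') → Spec B` is smooth.** [cite: StacksProject, Tag 09H0; Tag 00TG] -/
theorem smooth_specMap_baseChange (K K' B : Type) [Field K] [Field K'] [Algebra K K'] [FiniteDimensional K K']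
    [Algebra.IsSeparable K K'] [CommRing B] [Algebra K B] :
    Smooth (Spec.map (CommRingCat.ofHom (algebraMap B (B ⊗[K] K')))) := by
  haveI : Algebra.FormallyEtale K K' := Algebra.FormallyEtale.of_isSeparable K K'
  haveI : Algebra.FormallySmooth K K' := inferInstance
  haveI : Algebra.FinitePresentation K K' :=
    (Algebra.FinitePresentation.of_finiteType (R := K) (A := K')).mp inferInstance
  haveI : Algebra.Smooth K K' := ⟨inferInstance, inferInstance⟩
  haveI : Algebra.Smooth B (B ⊗[K] K') := inferInstance
  rw [HasRingHomProperty.Spec_iff (P := @Smooth), CommRingCat.hom_ofHom, RingHom.smooth_algebraMap]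
  infer_instance

/-- **Regularity ascends along the separable base change**: for `B` Noetherian, a point of `Spec(B ⊗_K K')` lying over a
regular point of `Spec B` is regular. [cite: Grothendieck1967, Prop. 17.5.8 (iii)] -/
theorem mem_regularLocus_baseChange (K K' B : Type) [Field K] [Field K'] [Algebra K K'] [FiniteDimensional K K']
    [Algebra.IsSeparable K K'] [CommRing B] [Algebra K B] [IsNoetherianRing B] (x : Spec (.of (B ⊗[K] K')))
    (hx : (⟨x.asIdeal.comap (algebraMap B (B ⊗[K] K')), inferInstance⟩ : Spec (.of B)) ∈
      Scheme.regularLocus (Spec (.of B))) :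
    x ∈ Scheme.regularLocus (Spec (.of (B ⊗[K] K'))) := by
  haveI := smooth_specMap_baseChange K K' B
  rw [Scheme.mem_regularLocus]
  refine isRegularLocalRing_stalk_of_smooth (Spec.map (CommRingCat.ofHom (algebraMap B (B ⊗[K] K')))) x ?_
  exact (Scheme.mem_regularLocus _).mp hx

/-- **`hloc` from ONE decomposition-stable primary piece at ONE point over `𝔭`** — as
`…GaloisOrbitAssembly.hloc_of_decomposition_stable_piece`, with the regularity of `Spec(B ⊗_K K')` off `𝔭` DERIVED from that of
`Spec B`. [cite: Grothendieck1967, Prop. 17.5.8 (iii)] [cite: StacksProject, Tag 0CDQ; Tag 09EB] [cite: Kollar2007, §2.2] -/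
theorem hloc_of_decomposition_stable_piece' (K : Type) [Field K] (X : Scheme.{0}) [IsIntegral X]
    (f : X ⟶ Spec (.of K)) [LocallyOfFiniteType f]
    {B : Type} [CommRing B] [IsDomain B] [Algebra K B] [Algebra.FiniteType K B]
    (ι : Spec (.of B) ⟶ X) [IsOpenImmersion ι] (hι : ι ≫ f = Spec.map (CommRingCat.ofHom (algebraMap K B)))
    (𝔭 : Ideal B) [h𝔭 : 𝔭.IsMaximal] (h𝔭0 : 𝔭 ≠ ⊥)
    (hsing : ι ⟨𝔭, h𝔭.isPrime⟩ ∉ Scheme.regularLocus X)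
    (hregB : ∀ P : Spec (.of B), P.asIdeal ≠ 𝔭 → P ∈ Scheme.regularLocus (Spec (.of B)))
    (K' : Type) [Field K'] [Algebra K K'] [FiniteDimensional K K'] [IsGalois K K']
    (𝔔' : Ideal (B ⊗[K] K')) [h𝔔' : 𝔔'.IsMaximal] (h𝔔'𝔭 : 𝔔'.comap (algebraMap B (B ⊗[K] K')) = 𝔭)
    (I : Ideal (B ⊗[K] K')) {n : ℕ} (hpI : 𝔔' ^ n ≤ I) (hIp : I ≤ 𝔔')
    (hD : ∀ σ : K' ≃ₐ[K] K',
      𝔔'.map (Algebra.TensorProduct.map (AlgHom.id B B) (σ : K' →ₐ[K] K')) = 𝔔' →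
      I.map (Algebra.TensorProduct.map (AlgHom.id B B) (σ : K' →ₐ[K] K')) ≤ I)
    (hreg : ∃ g : B ⊗[K] K', g ∉ 𝔔' ∧
      Scheme.IsRegular (affineBlowup (I.map (algebraMap (B ⊗[K] K') (Localization.Away g))))) :
    ∃ (V : X.Opens), ι ⟨𝔭, h𝔭.isPrime⟩ ∈ V ∧
      (∀ t : X, t ∉ Scheme.regularLocus X → t ∈ V → t = ι ⟨𝔭, h𝔭.isPrime⟩) ∧
      ∃ (Y : Scheme.{0}) (ρ : Y ⟶ V), IsProper ρ ∧ Scheme.IsRegular Y ∧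
        IsIso (ρ ∣_ (V.ι ⁻¹ᵁ ⟨Scheme.regularLocus X, isOpen_regularLocus_of_locallyOfFiniteType_field f⟩)) ∧
        Dense ((ρ ⁻¹ᵁ (V.ι ⁻¹ᵁ ⟨Scheme.regularLocus X,
          isOpen_regularLocus_of_locallyOfFiniteType_field f⟩) : Y.Opens) : Set Y) := by
  haveI : IsNoetherianRing B := Algebra.FiniteType.isNoetherianRing K B
  refine GaloisOrbitAssembly.hloc_of_decomposition_stable_piece K X f ι hι 𝔭 h𝔭0 hsing hregB K' (fun x hx => ?_)
    𝔔' h𝔔'𝔭 I hpI hIp hD hreg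
  exact mem_regularLocus_baseChange K K' B x (hregB _ hx)

/-- **THE GALOIS ROUTE, SCHEME SIDE (off-`𝔭` regularity discharged).** As
`…GaloisOrbitAssembly.hasResolution_of_decomposition_stable_pieces` without the hypothesis on `Spec(B ⊗_K K')`: an integral `X`
locally of finite type over any field `K` with finitely many singular points, each carrying an affine open `Spec B` (`𝔭` maximal `≠ 0`,
`Spec B ∖ {𝔭}` regular), a finite Galois `K'/K`, ONE maximal `𝔔'` of `B ⊗_K K'` over `𝔭` and a decomposition-stable `𝔔'`-primary piece
with locally regular blow-up, has a resolution of singularities. [cite: StacksProject, Tag 0CDQ; Tag 09EB] [cite: Kollar2007, §2.2] -/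
theorem hasResolution_of_decomposition_stable_pieces' (K : Type) [Field K] (X : Scheme.{0}) [IsIntegral X]
    (f : X ⟶ Spec (.of K)) [LocallyOfFiniteType f] (hfin : (Scheme.regularLocus X)ᶜ.Finite)
    (hchart : ∀ s : X, s ∉ Scheme.regularLocus X →
      ∃ (B : Type) (_ : CommRing B) (_ : IsDomain B) (_ : Algebra K B) (_ : Algebra.FiniteType K B)
        (ι : Spec (.of B) ⟶ X) (_ : IsOpenImmersion ι)
        (_ : ι ≫ f = Spec.map (CommRingCat.ofHom (algebraMap K B)))
        (𝔭 : Ideal B) (h𝔭 : 𝔭.IsMaximal) (_ : 𝔭 ≠ ⊥) (_ : ι ⟨𝔭, h𝔭.isPrime⟩ = s)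
        (_ : ∀ P : Spec (.of B), P.asIdeal ≠ 𝔭 → P ∈ Scheme.regularLocus (Spec (.of B)))
        (K' : Type) (_ : Field K') (_ : Algebra K K') (_ : FiniteDimensional K K') (_ : IsGalois K K')
        (𝔔' : Ideal (B ⊗[K] K')) (_ : 𝔔'.IsMaximal) (I : Ideal (B ⊗[K] K')) (n : ℕ),
          𝔔'.comap (algebraMap B (B ⊗[K] K')) = 𝔭 ∧ 𝔔' ^ n ≤ I ∧ I ≤ 𝔔' ∧
          (∀ σ : K' ≃ₐ[K] K',
            𝔔'.map (Algebra.TensorProduct.map (AlgHom.id B B) (σ : K' →ₐ[K] K')) = 𝔔' →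
            I.map (Algebra.TensorProduct.map (AlgHom.id B B) (σ : K' →ₐ[K] K')) ≤ I) ∧
          ∃ g : B ⊗[K] K', g ∉ 𝔔' ∧
            Scheme.IsRegular (affineBlowup (I.map (algebraMap (B ⊗[K] K') (Localization.Away g))))) :
    Scheme.HasResolution X := by
  refine IsolatedGlue.hasResolution_of_finite_singularLocus_of_local K X f hfin fun s hs => ?_
  obtain ⟨B, _, _, _, _, ι, _, hι, 𝔭, h𝔭, h𝔭0, hιs, hregB, K', _, _, _, _, 𝔔', _, I, n, h𝔔'𝔭, hpI, hIp, hD, hreg⟩ :=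
    hchart s hs
  subst hιs
  exact hloc_of_decomposition_stable_piece' K X f ι hι 𝔭 h𝔭0 hs hregB K' 𝔔' h𝔔'𝔭 I hpI hIp hD hreg

end Summit.ResolutionOfSingularities.ResolutionOfSingularities.Theorems.FRationalResolution.GaloisBaseChangeRegular

end
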